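import Literature.NumberTheory.LFunctions.Zhang2022.TerminalBlockIIS

/-!
# Zhang (2022): the terminal block under one-parameter changes of its file literals (levers)

Trunk T-ANT (NumberTheory/LFunctions). Y. Zhang, *Discrete mean estimates and the Landau–Siegel
zero*, arXiv:2211.02515v1 (2022) [Zhang2022LandauSiegel] — an unrefereed manuscript under
adjudication (cell pub-zhang: audit + repair census; **no claim about Landau–Siegel**). **Nothing in
this file asserts or denies its Theorems 1–2, its Propositions 2.1–2.6, 14.1, or any analytic
lemma.** It is the kernel face of row S2-15 of the cell's sweep seat 2 (binding-constraint map,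
`results/sweep-2/IIS-COVER-v9.md`, `BINDING-MAP-v10.md`; constraint file `sweep/CONSTRAINTS-v9.json`
= v10 = v11 = v12 on the 19 terminal rows): the companion module `TerminalBlockIIS` fixes every
non-threshold name of the 19 terminal rows at its FILE value and proves that the whole block is
infeasible over ℝ⁴ (`TerminalBlock.not_feasible_univ`), with 372 minimal infeasible subsystems.
Here the twelve file literals that bound a threshold are made PARAMETERS (`Levers`: the four
certified / printed lower bounds for the (2.32)-constant `q232`, the four lower bounds for the
(2.33)-constant `cJ`, the two linear caps and the two square caps on `d24`), the 19 checks are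
re-transcribed over them (`holdsAt`; at the file values `fileLevers` they are the checks of
`TerminalBlockIIS` by `rfl`, `holdsAt_file`), and the feasibility of the WHOLE block is decided in
closed form:

* `feasibleAt_univ_iff`: if the largest (2.32)-floor `qMax` and the largest (2.33)-floor `jMax` are
  `≥ 0` and the two linear caps are `> 0`, then all 19 rows are simultaneously satisfiable iff
  `qMax * jMax < capMin`, the least of the four caps on `d24²` (proof: `→` chains the rows
  floor < q232, floor < cJ, q232·cJ < d24² < caps; `←` is an explicit witness
  d24 = √s, c25 = √m, q232 = qMax + δ, cJ = jMax + δ with qMax·jMax < m < s < capMin);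
* at the file values `qMax = 553459320/10¹⁰` (the certified (2.32) main order, row `N-III.18sum`),
  `jMax = 880000000/314159` (the manuscript's own (18.3) floor 8800/π·10⁵/10⁵, row `III-18.03f`),
  `capMin = 25` (the linear cap thr24 ≤ 5 of `N-II.10.17a`), and `qMax * jMax = 1217610504/7853975
  ≈ 155.03 ≥ 25` (`file_values`, `not_feasibleAt_file` — the same fact as `not_feasible_univ`);
* the three one-parameter LEVERS of the cell's repair census (sweep-2 gen 7, `iis_cover.py`, farm
  job j060145; identical on v10/v11/v12): scaling every certified (2.32)-floor to a common value `p`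
  restores feasibility iff `p < 314159/35200000 ≈ 0.0089250` (`lever232_iff`; file 0.0553…, the
  manuscript's printed 0.0008 would pass); scaling every (2.33)-floor to `J` iff
  `J < 6250000000/13836483 ≈ 451.70` (`lever233_iff`; file ≥ 2546.8); relaxing every cap on `d24`
  to `u` resp. `u²` iff `1217610504/7853975 < u²`, i.e. `u > 12.451…` (`leverCap_iff`; file 5 resp.
  28.079). These are breakevens of the CONSTRAINT FILE's terminal rows as typed — statements about
  which parameter changes would make the file's endgame rows consistent, not about whether any such
  change is attainable.

[cite: Zhang2022LandauSiegel, §2 (2.18)–(2.19), (2.32)–(2.33), Props. 2.4–2.5, §10 (10.17), §18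
(18.2)–(18.3)]
-/

noncomputable section

namespace Literature.NumberTheory.LFunctions.Zhang2022

namespace TerminalBlock

open Finset

/-- The twelve file literals of the terminal rows that bound a threshold, as parameters:
`pG ps psum p02b` — the lower bounds for `q232` of rows `N-2.32Gs`, `N-2.32s`, `N-III.18sum`,
`III-18.02b`; `n03f` — the numerator of `III-18.03f` (`n03f < cJ * 314159`); `Jn Js Ja` — the lower
bounds for `cJ` of `N-2.33n`, `N-2.33s`, `N-II.2.33a`; `l1 l2` — the two caps on `d24` of
`N-II.10.17a` (`d24 < l1 ∧ d24 ≤ l2`); `sN sS` — the caps on `d24²` of `N-P2.4n`, `N-P2.4s`.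
[cite: Zhang2022LandauSiegel, §2 (2.32)–(2.33), Props. 2.4–2.5, §10 (10.17), §18 (18.2)–(18.3)] -/
structure Levers where
  pG : ℝ
  ps : ℝ
  psum : ℝ
  p02b : ℝ
  n03f : ℝ
  Jn : ℝ
  Js : ℝ
  Ja : ℝ
  l1 : ℝ
  l2 : ℝ
  sN : ℝ
  sS : ℝ

/-- The checks of the 19 terminal rows with the twelve literals replaced by the lever values (every
other literal as in `Row.holds`). [cite: Zhang2022LandauSiegel, §2, §10 (10.17), §18 (18.2)–(18.3)] -/
def holdsAt (ℓ : Levers) : Row → Thresholds → Prop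
  | .I_2_32a, t => t.q232 * t.cJ < t.c25 * t.c25
  | .I_P2_4a, t => 0 < t.d24
  | .I_P2_5a, t => 0 < t.c25
  | .I_T9a, t => t.c25 < t.d24
  | .III_18_02b, t => ℓ.p02b < t.q232
  | .III_18_03f, t => ℓ.n03f < t.cJ * 314159
  | .III_2_P25a, t => t.q232 * t.cJ < t.c25 ^ 2
  | .III_2_P25b, t => 0 < t.c25 ∧ 0 ≤ t.q232 ∧ 0 ≤ t.cJ
  | .III_2_asm, t => t.c25 < t.d24
  | .N_2_32Gs, t => ℓ.pG < t.q232
  | .N_2_32s, t => ℓ.ps < t.q232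
  | .N_2_33n, t => ℓ.Jn < t.cJ
  | .N_2_33s, t => ℓ.Js < t.cJ
  | .N_II_10_17a, t => (5.1458823 : ℝ) - 0.04 < 5.1459074120 ∧ (5.1 : ℝ) < 5.1458823 - 0.04 ∧
      |(0.0129584722 : ℝ)| < 0.1 ∧ (0 : ℝ) < 0.0129584722 ∧ t.d24 < ℓ.l1 ∧ t.d24 ≤ ℓ.l2
  | .N_II_2_33a, t => ℓ.Ja < t.cJ
  | .N_III_18sum, t => ℓ.psum < t.q232
  | .N_P2_4n, t => t.d24 ^ 2 < ℓ.sN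
  | .N_P2_4s, t => t.d24 ^ 2 < ℓ.sS
  | .N_P2_5s, t => t.q232 * t.cJ < t.d24 ^ 2

/-- `FeasibleAt ℓ S`: the rows of `S`, read at lever values `ℓ`, are simultaneously satisfiable
over ℝ⁴. [folklore] -/
def FeasibleAt (ℓ : Levers) (S : Finset Row) : Prop := ∃ t : Thresholds, ∀ r ∈ S, holdsAt ℓ r t

/-- The file values of the twelve literals (constraint file v7 = … = v12 on these rows), written
exactly as in `Row.holds`. [cite: Zhang2022LandauSiegel, §2, §10 (10.17), §18 (18.2)–(18.3)] -/
def fileLevers : Levers where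
  pG := 2491 / 100000
  ps := 2767 / 50000
  psum := 553459320 / 10 ^ 10
  p02b := 6.9955 + 6.9955 + 2 * (-6.9951)
  n03f := 2 * 4400 * 100000
  Jn := 6367119 / 2500
  Js := 12734239 / 5000
  Ja := 2546.8477030
  l1 := 5.2989794526
  l2 := 5.1 - 0.1
  sN := 35099 / 1250
  sS := 280791 / 10000

/-- At the file values the parametrised checks ARE the checks of `TerminalBlockIIS` (by `rfl`, row
by row). [cite: Zhang2022LandauSiegel, §2, §10 (10.17), §18 (18.2)–(18.3)] -/
theorem holdsAt_file (r : Row) (t : Thresholds) : holdsAt fileLevers r t ↔ r.holds t := by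
  cases r <;> exact Iff.rfl

/-- Hence feasibility at the file values is feasibility in the sense of `TerminalBlockIIS`.
[folklore] -/
theorem feasibleAt_file_iff (S : Finset Row) : FeasibleAt fileLevers S ↔ Feasible S := by
  simp only [FeasibleAt, Feasible, Sat, holdsAt_file]

/-- The largest lower bound for `q232` among the four (2.32)-rows. [folklore] -/
def Levers.qMax (ℓ : Levers) : ℝ := max (max ℓ.pG ℓ.ps) (max ℓ.psum ℓ.p02b)

/-- The largest lower bound for `cJ` among the four (2.33)-rows (`III-18.03f` contributes
`n03f / 314159`). [folklore] -/
def Levers.jMax (ℓ : Levers) : ℝ := max (max (ℓ.n03f / 314159) ℓ.Jn) (max ℓ.Js ℓ.Ja)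

/-- The least cap on `d24²` among the four cap rows (`l1²`, `l2²`, `sN`, `sS`). [folklore] -/
def Levers.capMin (ℓ : Levers) : ℝ := min (min (ℓ.l1 ^ 2) (ℓ.l2 ^ 2)) (min ℓ.sN ℓ.sS)

/-- **The terminal block in closed form.** With non-negative floors and positive linear caps, the 19
terminal rows are simultaneously satisfiable at lever values `ℓ` iff `qMax · jMax < capMin`.
[cite: Zhang2022LandauSiegel, §2 (2.18)–(2.19), (2.32)–(2.33), Props. 2.4–2.5, §10 (10.17), §18
(18.2)–(18.3)] -/
theorem feasibleAt_univ_iff (ℓ : Levers) (hq : 0 ≤ ℓ.qMax) (hJ : 0 ≤ ℓ.jMax) (hl1 : 0 < ℓ.l1)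
    (hl2 : 0 < ℓ.l2) : FeasibleAt ℓ univ ↔ ℓ.qMax * ℓ.jMax < ℓ.capMin := by
  constructor
  · rintro ⟨t, ht⟩
    have h : ∀ r, holdsAt ℓ r t := fun r => ht r (mem_univ r)
    have hG : ℓ.pG < t.q232 := h .N_2_32Gs
    have hs : ℓ.ps < t.q232 := h .N_2_32s
    have hsum : ℓ.psum < t.q232 := h .N_III_18sum
    have h02 : ℓ.p02b < t.q232 := h .III_18_02b
    have h03 : ℓ.n03f < t.cJ * 314159 := h .III_18_03f
    have hJn : ℓ.Jn < t.cJ := h .N_2_33n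
    have hJs : ℓ.Js < t.cJ := h .N_2_33s
    have hJa : ℓ.Ja < t.cJ := h .N_II_2_33a
    have hSq : t.q232 * t.cJ < t.d24 ^ 2 := h .N_P2_5s
    have hd0 : 0 < t.d24 := h .I_P2_4a
    have hAN : t.d24 ^ 2 < ℓ.sN := h .N_P2_4n
    have hAS : t.d24 ^ 2 < ℓ.sS := h .N_P2_4s
    have hL : (5.1458823 : ℝ) - 0.04 < 5.1459074120 ∧ (5.1 : ℝ) < 5.1458823 - 0.04 ∧
        |(0.0129584722 : ℝ)| < 0.1 ∧ (0 : ℝ) < 0.0129584722 ∧ t.d24 < ℓ.l1 ∧ t.d24 ≤ ℓ.l2 :=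
      h .N_II_10_17a
    obtain ⟨-, -, -, -, hc1, hc2⟩ := hL
    have hqm : ℓ.qMax < t.q232 := max_lt (max_lt hG hs) (max_lt hsum h02)
    have h03' : ℓ.n03f / 314159 < t.cJ := by linarith
    have hjm : ℓ.jMax < t.cJ := max_lt (max_lt h03' hJn) (max_lt hJs hJa)
    have hP : ℓ.qMax * ℓ.jMax ≤ t.q232 * t.cJ := mul_le_mul hqm.le hjm.le hJ (hq.trans hqm.le)
    have h1 : t.d24 ^ 2 < ℓ.l1 ^ 2 := by nlinarith
    have h2 : t.d24 ^ 2 ≤ ℓ.l2 ^ 2 := by nlinarith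
    refine lt_min (lt_min ?_ ?_) (lt_min ?_ ?_) <;> linarith
  · intro hP
    have hP0 : 0 ≤ ℓ.qMax * ℓ.jMax := mul_nonneg hq hJ
    obtain ⟨s, hPs, hsc⟩ := exists_between hP
    obtain ⟨m, hPm, hms⟩ := exists_between hPs
    have hs0 : 0 < s := lt_of_le_of_lt hP0 hPs
    have hm0 : 0 < m := lt_of_le_of_lt hP0 hPm
    have hK : 0 < 2 * (ℓ.qMax + ℓ.jMax + 1) := by linarith
    obtain ⟨c, hc0, hc⟩ := exists_pos_mul_lt (sub_pos.mpr hPm) (2 * (ℓ.qMax + ℓ.jMax + 1))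
    obtain ⟨δ, hδ0, hδ1, hδK⟩ : ∃ δ : ℝ, 0 < δ ∧ δ ≤ 1 ∧
        2 * (ℓ.qMax + ℓ.jMax + 1) * δ < m - ℓ.qMax * ℓ.jMax :=
      ⟨min 1 c, lt_min one_pos hc0, min_le_left _ _,
        lt_of_le_of_lt (mul_le_mul_of_nonneg_left (min_le_right _ _) hK.le) hc⟩
    have hδδ : δ * δ ≤ δ := by nlinarith
    have hprod : (ℓ.qMax + δ) * (ℓ.jMax + δ) < m := by nlinarith
    have hd2 : Real.sqrt s ^ 2 = s := Real.sq_sqrt hs0.le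
    have hc2 : Real.sqrt m ^ 2 = m := Real.sq_sqrt hm0.le
    have hcc : Real.sqrt m * Real.sqrt m = m := Real.mul_self_sqrt hm0.le
    have hd0 : 0 < Real.sqrt s := Real.sqrt_pos.mpr hs0
    have hcp : 0 < Real.sqrt m := Real.sqrt_pos.mpr hm0
    have hcd : Real.sqrt m < Real.sqrt s := Real.sqrt_lt_sqrt hm0.le hms
    have cap1 : s < ℓ.l1 ^ 2 := lt_of_lt_of_le hsc ((min_le_left _ _).trans (min_le_left _ _))
    have cap2 : s < ℓ.l2 ^ 2 := lt_of_lt_of_le hsc ((min_le_left _ _).trans (min_le_right _ _))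
    have cap3 : s < ℓ.sN := lt_of_lt_of_le hsc ((min_le_right _ _).trans (min_le_left _ _))
    have cap4 : s < ℓ.sS := lt_of_lt_of_le hsc ((min_le_right _ _).trans (min_le_right _ _))
    have hdl1 : Real.sqrt s < ℓ.l1 := by nlinarith
    have hdl2 : Real.sqrt s ≤ ℓ.l2 := by nlinarith
    have hq' : ℓ.qMax < ℓ.qMax + δ := lt_add_of_pos_right _ hδ0
    have hj' : ℓ.jMax < ℓ.jMax + δ := lt_add_of_pos_right _ hδ0
    have fG : ℓ.pG ≤ ℓ.qMax := (le_max_left _ _).trans (le_max_left _ _)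
    have fs : ℓ.ps ≤ ℓ.qMax := (le_max_right _ _).trans (le_max_left _ _)
    have fsum : ℓ.psum ≤ ℓ.qMax := (le_max_left _ _).trans (le_max_right _ _)
    have f02 : ℓ.p02b ≤ ℓ.qMax := (le_max_right _ _).trans (le_max_right _ _)
    have f03 : ℓ.n03f / 314159 ≤ ℓ.jMax := (le_max_left _ _).trans (le_max_left _ _)
    have fJn : ℓ.Jn ≤ ℓ.jMax := (le_max_right _ _).trans (le_max_left _ _)
    have fJs : ℓ.Js ≤ ℓ.jMax := (le_max_left _ _).trans (le_max_right _ _)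
    have fJa : ℓ.Ja ≤ ℓ.jMax := (le_max_right _ _).trans (le_max_right _ _)
    refine ⟨⟨Real.sqrt s, Real.sqrt m, ℓ.qMax + δ, ℓ.jMax + δ⟩, fun r _ => ?_⟩
    cases r <;> simp only [holdsAt]
    · rw [hcc]; exact hprod
    · exact hd0
    · exact hcp
    · exact hcd
    · exact lt_of_le_of_lt f02 hq'
    · linarith
    · rw [hc2]; exact hprod
    · exact ⟨hcp, by linarith, by linarith⟩
    · exact hcd
    · exact lt_of_le_of_lt fG hq'
    · exact lt_of_le_of_lt fs hq'
    · exact lt_of_le_of_lt fJn hj'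
    · exact lt_of_le_of_lt fJs hj'
    · refine ⟨by norm_num, by norm_num, by rw [abs_of_pos (by norm_num)]; norm_num, by norm_num,
        hdl1, hdl2⟩
    · exact lt_of_le_of_lt fJa hj'
    · exact lt_of_le_of_lt fsum hq'
    · rw [hd2]; exact cap3
    · rw [hd2]; exact cap4
    · rw [hd2]; exact hprod.trans hms

/-- The file values of the three aggregates: `qMax = 553459320/10¹⁰` (row `N-III.18sum`),
`jMax = 880000000/314159` (row `III-18.03f`), `capMin = 25` (row `N-II.10.17a`).
[cite: Zhang2022LandauSiegel, §2 (2.32)–(2.33), §10 (10.17), §18 (18.2)–(18.3)] -/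
theorem file_values : fileLevers.qMax = 553459320 / 10 ^ 10 ∧ fileLevers.jMax = 880000000 / 314159 ∧
    fileLevers.capMin = 25 := by
  refine ⟨?_, ?_, ?_⟩ <;> norm_num [fileLevers, Levers.qMax, Levers.jMax, Levers.capMin, max_def,
    min_def]

/-- At the file values `qMax · jMax = 1217610504/7853975 ≈ 155.03 ≥ 25 = capMin`: the whole block is
infeasible (the closed form re-derives `not_feasible_univ`).
[cite: Zhang2022LandauSiegel, §2 (2.32)–(2.33), §10 (10.17), §18 (18.2)–(18.3)] -/
theorem not_feasibleAt_file : ¬ FeasibleAt fileLevers univ := by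
  rw [feasibleAt_univ_iff fileLevers (by rw [file_values.1]; norm_num)
    (by rw [file_values.2.1]; norm_num) (by norm_num [fileLevers]) (by norm_num [fileLevers]),
    file_values.1, file_values.2.1, file_values.2.2]
  norm_num

/-- `not_feasibleAt_file` is `not_feasible_univ` of `TerminalBlockIIS` read through
`feasibleAt_file_iff`. [folklore] -/
theorem not_feasibleAt_file' : ¬ FeasibleAt fileLevers univ :=
  fun h => not_feasible_univ ((feasibleAt_file_iff _).mp h)

/-! ## The three levers of the repair census -/

/-- Lever L232: every CERTIFIED (2.32)-floor (`N-2.32Gs`, `N-2.32s`, `N-III.18sum`) scaled to a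
common value `p` (the manuscript's own `III-18.02b` value 0.0008 kept).
[cite: Zhang2022LandauSiegel, §2 (2.32), §18 (18.2)] -/
def lever232 (p : ℝ) : Levers := { fileLevers with pG := p, ps := p, psum := p }

/-- Lever L233: every (2.33)-floor (`III-18.03f`, `N-2.33n`, `N-2.33s`, `N-II.2.33a`) scaled to a
common value `J`. [cite: Zhang2022LandauSiegel, §2 (2.33), §18 (18.3)] -/
def lever233 (J : ℝ) : Levers := { fileLevers with n03f := J * 314159, Jn := J, Js := J, Ja := J }

/-- Lever CAP: every cap on `d24` (`N-II.10.17a` twice, `N-P2.4n`, `N-P2.4s`) relaxed to `u` resp.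
`u²`. [cite: Zhang2022LandauSiegel, Prop. 2.4, §10 (10.17)] -/
def leverCap (u : ℝ) : Levers := { fileLevers with l1 := u, l2 := u, sN := u ^ 2, sS := u ^ 2 }

/-- Under lever L232 the largest (2.32)-floor is `max p (1/1250)` (1/1250 = 0.0008, row `III-18.02b`).
[cite: Zhang2022LandauSiegel, §2 (2.32)–(2.33), §10 (10.17), §18 (18.2)–(18.3)] -/
theorem lever232_qMax (p : ℝ) : (lever232 p).qMax = max p (1 / 1250) := by
  have h : (6.9955 : ℝ) + 6.9955 + 2 * (-6.9951) = 1 / 1250 := by norm_num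
  simp only [Levers.qMax, lever232, fileLevers, max_self, h]
  rw [← max_assoc, max_self]

/-- Lever L232 leaves the (2.33)-floors at the file value `880000000/314159`. [cite: Zhang2022LandauSiegel, §2 (2.32)–(2.33), §10 (10.17), §18 (18.2)–(18.3)] -/
theorem lever232_jMax (p : ℝ) : (lever232 p).jMax = 880000000 / 314159 := by
  have := file_values.2.1
  simpa [Levers.jMax, lever232, fileLevers] using this

/-- Lever L232 leaves the caps at the file value `25`. [cite: Zhang2022LandauSiegel, §2 (2.32)–(2.33), §10 (10.17), §18 (18.2)–(18.3)] -/
theorem lever232_capMin (p : ℝ) : (lever232 p).capMin = 25 := by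
  have := file_values.2.2
  simpa [Levers.capMin, lever232, fileLevers] using this

/-- **Breakeven of lever L232**: `p < 314159/35200000 = 25·314159/880000000 ≈ 0.0089250` (file:
0.0553459320; printed: 0.0008 + 0.0002). [cite: Zhang2022LandauSiegel, §2 (2.32)–(2.33), §10
(10.17), §18 (18.2)–(18.3)] -/
theorem lever232_iff {p : ℝ} (hp : 0 ≤ p) :
    FeasibleAt (lever232 p) univ ↔ p < 314159 / 35200000 := by
  have hq : 0 ≤ (lever232 p).qMax := by rw [lever232_qMax]; exact hp.trans (le_max_left _ _)
  rw [feasibleAt_univ_iff _ hq (by rw [lever232_jMax]; norm_num) (by norm_num [lever232, fileLevers])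
    (by norm_num [lever232, fileLevers]), lever232_qMax, lever232_jMax, lever232_capMin]
  constructor
  · intro h
    have := le_max_left p (1 / 1250)
    nlinarith
  · intro h
    rcases max_choice p (1 / 1250) with hm | hm <;> rw [hm]
    · nlinarith
    · norm_num

/-- Lever L233 leaves the (2.32)-floors at the file value `553459320/10¹⁰`. [cite: Zhang2022LandauSiegel, §2 (2.32)–(2.33), §10 (10.17), §18 (18.2)–(18.3)] -/
theorem lever233_qMax (J : ℝ) : (lever233 J).qMax = 553459320 / 10 ^ 10 := by
  have := file_values.1
  simpa [Levers.qMax, lever233, fileLevers] using this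

/-- Under lever L233 the largest (2.33)-floor is `J`. [cite: Zhang2022LandauSiegel, §2 (2.32)–(2.33), §10 (10.17), §18 (18.2)–(18.3)] -/
theorem lever233_jMax (J : ℝ) : (lever233 J).jMax = J := by
  have h : J * 314159 / 314159 = J := by field_simp
  simp only [Levers.jMax, lever233, fileLevers, h, max_self]

/-- Lever L233 leaves the caps at the file value `25`. [cite: Zhang2022LandauSiegel, §2 (2.32)–(2.33), §10 (10.17), §18 (18.2)–(18.3)] -/
theorem lever233_capMin (J : ℝ) : (lever233 J).capMin = 25 := by
  have := file_values.2.2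
  simpa [Levers.capMin, lever233, fileLevers] using this

/-- **Breakeven of lever L233**: `J < 6250000000/13836483 = 25·10¹⁰/553459320 ≈ 451.70` (file:
every (2.33)-floor ≥ 2546.84). [cite: Zhang2022LandauSiegel, §2 (2.32)–(2.33), §10 (10.17), §18
(18.2)–(18.3)] -/
theorem lever233_iff {J : ℝ} (hJ : 0 ≤ J) :
    FeasibleAt (lever233 J) univ ↔ J < 6250000000 / 13836483 := by
  rw [feasibleAt_univ_iff _ (by rw [lever233_qMax]; norm_num) (by rw [lever233_jMax]; exact hJ)
    (by norm_num [lever233, fileLevers]) (by norm_num [lever233, fileLevers]), lever233_qMax,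
    lever233_jMax, lever233_capMin]
  constructor <;> intro h <;> nlinarith

/-- Lever CAP leaves the (2.32)-floors at the file value `553459320/10¹⁰`. [cite: Zhang2022LandauSiegel, §2 (2.32)–(2.33), §10 (10.17), §18 (18.2)–(18.3)] -/
theorem leverCap_qMax (u : ℝ) : (leverCap u).qMax = 553459320 / 10 ^ 10 := by
  have := file_values.1
  simpa [Levers.qMax, leverCap, fileLevers] using this

/-- Lever CAP leaves the (2.33)-floors at the file value `880000000/314159`. [cite: Zhang2022LandauSiegel, §2 (2.32)–(2.33), §10 (10.17), §18 (18.2)–(18.3)] -/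
theorem leverCap_jMax (u : ℝ) : (leverCap u).jMax = 880000000 / 314159 := by
  have := file_values.2.1
  simpa [Levers.jMax, leverCap, fileLevers] using this

/-- Under lever CAP the least cap on `d24²` is `u²`. [cite: Zhang2022LandauSiegel, §2 (2.32)–(2.33), §10 (10.17), §18 (18.2)–(18.3)] -/
theorem leverCap_capMin (u : ℝ) : (leverCap u).capMin = u ^ 2 := by
  simp only [Levers.capMin, leverCap, min_self]

/-- **Breakeven of lever CAP**: `1217610504/7853975 < u²` (≈ 155.03, i.e. `u > 12.451`; file: 5 resp.
28.079). [cite: Zhang2022LandauSiegel, §2 (2.32)–(2.33), §10 (10.17), §18 (18.2)–(18.3)] -/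
theorem leverCap_iff {u : ℝ} (hu : 0 < u) :
    FeasibleAt (leverCap u) univ ↔ 1217610504 / 7853975 < u ^ 2 := by
  rw [feasibleAt_univ_iff _ (by rw [leverCap_qMax]; norm_num) (by rw [leverCap_jMax]; norm_num)
    (by simpa [leverCap] using hu) (by simpa [leverCap] using hu), leverCap_qMax, leverCap_jMax,
    leverCap_capMin]
  norm_num

end TerminalBlock

end Literature.NumberTheory.LFunctions.Zhang2022
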